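import Literature.NumberTheory.LFunctions.RHClassicalEquivalents
import Literature.NumberTheory.LFunctions.NymanBeurlingDirichlet
import Literature.NumberTheory.LFunctions.NymanBeurlingProofs
import Literature.NumberTheory.LFunctions.RHZetaRatioBound
import Literature.NumberTheory.LFunctions.MoebiusRieszPerron
import HarnessLib

/-!
# The Nyman–Beurling–Báez-Duarte criterion, critical-line form: proof of the deep half

Topic: `Literature/NumberTheory/LFunctions`. Companion ("Proofs") file of
`Literature/NumberTheory/LFunctions/RHClassicalEquivalents.lean`. It proves the named facts
`Literature.NumberTheory.LFunctions.baezDuarte_dirichlet_onlyIf` (`NymanBeurlingDirichlet.lean`) and hence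
`Literature.NumberTheory.LFunctions.baezDuarte_dirichlet_iff` (rh.S27, Mellin form; `RHClassicalEquivalents.lean`):

  RH `⇒` for every `ε > 0` some Dirichlet polynomial `A(s) = Σ_{k<N} a_k (k+1)^{-s}` has
  `∫_ℝ |1 - ζ(1/2+it) A(1/2+it)|² dt/(1/4+t²) < ε`

(L. Báez-Duarte, Rend. Lincei (9) 14 (2003), 5–11, Thm. 1.1, deep half, read on the critical line
through Mellin–Plancherel), the elementary half being
`Literature.NumberTheory.LFunctions.riemannHypothesis_of_dirichlet_approx`.

## The argument (Báez-Duarte §2.2, run on the line `Re s = 1/2`)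

Take `A(s) = M_n(s + δ)` with the Riesz means `M_n(w) = Σ_{a≤n} μ(a)(1-a/n)² a^{-w}` and split,
for `s = 1/2 + it`, `w = s + δ`,

  `1 - ζ(s) M_n(w) = [1 - ζ(s)/ζ(w)] + ζ(s) [1/ζ(w) - M_n(w)] = T₁ + T₂`.

* `T₁ → 0` in `L²(dt/(1/4+t²))` as `δ → 0⁺` by dominated convergence: pointwise `ζ(w) → ζ(s)`, so
  `T₁ → 0` off the (countable) zero set of `ζ` on the line, and
  `|ζ(s)/ζ(w)| ≤ C (1+|t|)^{δ/2}` uniformly in `δ` (`ZetaRatioRH.norm_riemannZeta_half_le_of_RH`: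
  Báez-Duarte's Lemma 2.2 — the functional equation — combined with the Phragmén–Lindelöf
  principle; this is where Báez-Duarte moves to the abscissa `1/2 - ε` and invokes "Lindelöf from
  RH").
* For fixed `δ`, `T₂ → 0` as `n → ∞`: `|ζ(s)| ≤ C(1+|t|)^{δ/2}|ζ(w)| ≤ C'(1+|t|)^{δ/2+1/8}`
  (Littlewood, Titchmarsh (14.2.5), `LittlewoodRH.norm_riemannZeta_line_le_of_RH`) and
  `|1/ζ(w) - M_n(w)| ≤ C n^{-δ/2}(1+|t|)^{1/8}` (`RieszPerron.norm_rieszSum_sub_inv_riemannZeta_le`: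
  Perron's formula and the contour shift allowed by RH with Titchmarsh (14.2.6) — the Riesz-mean
  form of Balazard–Saias' Lemme 2 = Báez-Duarte's Lemma 2.1).

## Main results

* `Literature.NumberTheory.LFunctions.baezDuarte_dirichlet_onlyIf_holds` — the deep half, proved.
* `Literature.NumberTheory.LFunctions.baezDuarte_dirichlet_iff_holds` — **discharge of `Literature.NumberTheory.LFunctions.baezDuarte_dirichlet_iff`**.

## Related

The function-space form of Theorem 1.1 (`Literature.NumberTheory.LFunctions.baezDuarte_iff`: `χ_(0,1]` in the `L²(0,∞)`-closure
of the span of `x ↦ {1/(kx)}`) is discharged independently in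
`Literature/NumberTheory/LFunctions/NymanBeurlingBaezDuarteProofs.lean`
(`Literature.NumberTheory.LFunctions.baezDuarte_iff_holds`, via Mellin–Plancherel and smoothed Möbius sums), and reduced to
Báez-Duarte's three printed inputs in `NymanBeurlingProofs.lean` (`Literature.NumberTheory.LFunctions.baezDuarte_iff_of_facts`);
the present file stays on the critical line and uses neither Mellin–Plancherel nor a line transfer.

## References

* L. Báez-Duarte, *A strengthening of the Nyman–Beurling criterion for the Riemann hypothesis*,
  Atti Accad. Naz. Lincei Rend. Lincei (9) Mat. Appl. 14 (2003), 5–11 (arXiv:math/0202141),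
  Thm. 1.1, Lemmas 2.1–2.2, §2.2.
* M. Balazard, E. Saias, *Notes sur la fonction ζ de Riemann, 1*, Adv. Math. 139 (1998), Lemme 2.
* E. C. Titchmarsh, *The Theory of the Riemann Zeta-Function*, 2nd ed. (1986), §14.2, §14.25.

The file has no definitions.
-/

noncomputable section

open Complex Filter Topology Set MeasureTheory
open scoped Real ENNReal

namespace Literature.NumberTheory.LFunctions

/-! ### Elementary inequalities -/

/-- `1/(1/4 + t²) ≤ 8 (1+|t|)^{-2}`. [folklore] -/
lemma inv_quarter_add_sq_le (t : ℝ) : 1 / (1 / 4 + t ^ 2) ≤ 8 * (1 + |t|) ^ (-(2 : ℝ)) := by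
  rw [Real.rpow_neg (by positivity), show (8 : ℝ) * ((1 + |t|) ^ (2 : ℝ))⁻¹ = 8 / (1 + |t|) ^ 2 by
    rw [Real.rpow_two]; ring]
  rw [div_le_div_iff₀ (by positivity) (by positivity)]
  nlinarith [sq_abs t, abs_nonneg t, sq_nonneg (|t| - 1)]

/-- `‖a + b‖² ≤ 2‖a‖² + 2‖b‖²`. [folklore] -/
lemma norm_add_sq_le_two (a b : ℂ) : ‖a + b‖ ^ 2 ≤ 2 * ‖a‖ ^ 2 + 2 * ‖b‖ ^ 2 := by
  have h := norm_add_le a b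
  nlinarith [norm_nonneg a, norm_nonneg b, norm_nonneg (a + b), sq_nonneg (‖a‖ - ‖b‖)]

/-! ### The term `T₁ = 1 - ζ(s)/ζ(s+δ)`: dominated convergence as `δ → 0⁺` -/

/-- Under RH, `t ↦ ζ(1/2 + δ + it)⁻¹` is continuous for `0 < δ < 1/2`. [folklore] -/
lemma continuous_inv_riemannZeta_line (hRH : RiemannHypothesis) {δ : ℝ} (hδ0 : 0 < δ)
    (hδ : δ < 1 / 2) : Continuous fun t : ℝ ↦ (riemannZeta (1 / 2 + δ + t * I))⁻¹ := by
  have hne1 : ∀ t : ℝ, (1 / 2 : ℂ) + δ + t * I ≠ 1 := by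
    intro t h; have := congrArg re h; simp at this; linarith
  have hcont : Continuous fun t : ℝ ↦ riemannZeta (1 / 2 + δ + t * I) := by
    have h1 : Continuous fun t : ℝ ↦ (1 / 2 : ℂ) + δ + t * I := by fun_prop
    exact continuous_iff_continuousAt.mpr fun t ↦
      ContinuousAt.comp (g := riemannZeta) (f := fun t : ℝ ↦ (1 / 2 : ℂ) + δ + t * I) (x := t)
        (differentiableAt_riemannZeta (hne1 t)).continuousAt h1.continuousAt
  refine hcont.inv₀ fun t ↦ InvZetaRH.riemannZeta_ne_zero_of_RH hRH ?_
  simp; linarith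

/-- **`T₁ → 0` in `L²(dt/(1/4+t²))`.** Under RH,
`∫ |1 - ζ(1/2+it)/ζ(1/2+δ+it)|² dt/(1/4+t²) → 0` as `δ → 0⁺` (dominated convergence: the ratio
bound `ZetaRatioRH.norm_riemannZeta_half_le_of_RH` gives the majorant, and the integrand tends to
`0` off the countable zero set of `ζ` on the critical line,
`BaezDuarteOnlyIf.ae_riemannZeta_half_ne_zero` of `NymanBeurlingProofs.lean`). This is
Báez-Duarte's step "`f_ε → -χ` in `L²`" (§2.2, last paragraph) on the Mellin side.
[cite: BaezDuarte2003, §2.2 (convergence `f_ε → -χ`)] -/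
theorem tendsto_lintegral_T1 (hRH : RiemannHypothesis) :
    Tendsto (fun δ : ℝ ↦ ∫⁻ t : ℝ, ENNReal.ofReal
      (‖1 - riemannZeta (1 / 2 + t * I) * (riemannZeta (1 / 2 + δ + t * I))⁻¹‖ ^ 2 /
        (1 / 4 + t ^ 2))) (𝓝[>] 0) (𝓝 0) := by
  obtain ⟨C, hC, hratio⟩ := ZetaRatioRH.norm_riemannZeta_half_le_of_RH hRH
  -- the majorant
  set M : ℝ → ℝ := fun t ↦ (1 + C * (1 + |t|) ^ (1 / 4 : ℝ)) ^ 2 / (1 / 4 + t ^ 2) with hM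
  have hMint : Integrable M := by
    have hr : (Module.finrank ℝ ℝ : ℝ) < 3 / 2 := by simp; norm_num
    have h := (integrable_one_add_norm (E := ℝ) (μ := volume) hr).const_mul (8 * (2 + 2 * C ^ 2))
    refine h.mono' ?_ (Eventually.of_forall fun t ↦ ?_)
    · refine Continuous.aestronglyMeasurable ?_
      simp only [hM]
      refine Continuous.div ?_ (by fun_prop) (fun t ↦ by positivity)
      refine (continuous_const.add (continuous_const.mul ?_)).pow 2
      exact (continuous_const.add continuous_abs).rpow_const fun t ↦ Or.inl (by
        show (1 : ℝ) + |t| ≠ 0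
        positivity)
    · have ht : 0 ≤ |t| := abs_nonneg t
      simp only [hM, Real.norm_eq_abs]
      rw [abs_of_nonneg (by positivity)]
      have h1 : (1 + C * (1 + |t|) ^ (1 / 4 : ℝ)) ^ 2 ≤
          (2 + 2 * C ^ 2) * (1 + |t|) ^ (1 / 2 : ℝ) := by
        have hp : ((1 + |t|) ^ (1 / 4 : ℝ)) ^ 2 = (1 + |t|) ^ (1 / 2 : ℝ) := by
          rw [← Real.rpow_natCast, ← Real.rpow_mul (by positivity)]; norm_num
        have hq : 1 ≤ (1 + |t|) ^ (1 / 2 : ℝ) := Real.one_le_rpow (by linarith) (by norm_num)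
        have h0 : 0 ≤ (1 + |t|) ^ (1 / 4 : ℝ) := by positivity
        nlinarith [sq_nonneg (1 - C * (1 + |t|) ^ (1 / 4 : ℝ))]
      have h2 := inv_quarter_add_sq_le t
      have hsplit :
          (1 + |t|) ^ (1 / 2 : ℝ) * (1 + |t|) ^ (-(2 : ℝ)) = (1 + |t|) ^ (-(3 / 2 : ℝ)) := by
        rw [← Real.rpow_add (by positivity)]; norm_num
      calc (1 + C * (1 + |t|) ^ (1 / 4 : ℝ)) ^ 2 / (1 / 4 + t ^ 2)
          = (1 + C * (1 + |t|) ^ (1 / 4 : ℝ)) ^ 2 * (1 / (1 / 4 + t ^ 2)) := by ring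
        _ ≤ ((2 + 2 * C ^ 2) * (1 + |t|) ^ (1 / 2 : ℝ)) * (8 * (1 + |t|) ^ (-(2 : ℝ))) := by
            gcongr
        _ = 8 * (2 + 2 * C ^ 2) * (1 + ‖t‖) ^ (-(3 / 2 : ℝ)) := by
            rw [Real.norm_eq_abs, ← hsplit]; ring
  -- pointwise bound on `T₁`
  have hT1 : ∀ δ : ℝ, 0 < δ → δ < 1 / 2 → ∀ t : ℝ,
      ‖1 - riemannZeta (1 / 2 + t * I) * (riemannZeta (1 / 2 + δ + t * I))⁻¹‖ ^ 2 /
        (1 / 4 + t ^ 2) ≤ M t := by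
    intro δ hδ0 hδ t
    have hζne : riemannZeta (1 / 2 + δ + t * I) ≠ 0 :=
      InvZetaRH.riemannZeta_ne_zero_of_RH hRH (by simp; linarith)
    have hpos : 0 < ‖riemannZeta (1 / 2 + δ + t * I)‖ := norm_pos_iff.mpr hζne
    have hr := hratio δ hδ0 hδ t
    have hq : ‖riemannZeta (1 / 2 + t * I)‖ * ‖riemannZeta (1 / 2 + δ + t * I)‖⁻¹ ≤
        C * (1 + |t|) ^ (1 / 4 : ℝ) := by
      rw [← div_eq_mul_inv, div_le_iff₀ hpos]
      refine hr.trans ?_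
      have hexp : (1 + |t|) ^ (δ / 2) ≤ (1 + |t|) ^ (1 / 4 : ℝ) :=
        Real.rpow_le_rpow_of_exponent_le (by linarith [abs_nonneg t]) (by linarith)
      exact mul_le_mul_of_nonneg_right (mul_le_mul_of_nonneg_left hexp hC.le) (norm_nonneg _)
    have hn : ‖1 - riemannZeta (1 / 2 + t * I) * (riemannZeta (1 / 2 + δ + t * I))⁻¹‖ ≤
        1 + C * (1 + |t|) ^ (1 / 4 : ℝ) := by
      calc ‖1 - riemannZeta (1 / 2 + t * I) * (riemannZeta (1 / 2 + δ + t * I))⁻¹‖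
          ≤ ‖(1 : ℂ)‖ + ‖riemannZeta (1 / 2 + t * I) * (riemannZeta (1 / 2 + δ + t * I))⁻¹‖ :=
            norm_sub_le _ _
        _ = 1 + ‖riemannZeta (1 / 2 + t * I)‖ * ‖riemannZeta (1 / 2 + δ + t * I)‖⁻¹ := by
            rw [norm_one, norm_mul, norm_inv]
        _ ≤ 1 + C * (1 + |t|) ^ (1 / 4 : ℝ) := by linarith
    simp only [hM]
    gcongr
  -- measurability, eventually in `δ`
  have hmeas : ∀ᶠ δ : ℝ in 𝓝[>] (0 : ℝ), Measurable fun t : ℝ ↦ ENNReal.ofReal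
      (‖1 - riemannZeta (1 / 2 + t * I) * (riemannZeta (1 / 2 + δ + t * I))⁻¹‖ ^ 2 /
        (1 / 4 + t ^ 2)) := by
    filter_upwards [Ioo_mem_nhdsGT (show (0 : ℝ) < 1 / 2 by norm_num)] with δ hδ
    refine ENNReal.measurable_ofReal.comp (Continuous.measurable ?_)
    refine Continuous.div ((continuous_const.sub (continuous_riemannZeta_line.mul
      (continuous_inv_riemannZeta_line hRH hδ.1 hδ.2))).norm.pow 2) (by fun_prop)
      (fun t ↦ by positivity)
  -- domination
  have hbound : ∀ᶠ δ : ℝ in 𝓝[>] (0 : ℝ), ∀ᵐ t : ℝ, ENNReal.ofReal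
      (‖1 - riemannZeta (1 / 2 + t * I) * (riemannZeta (1 / 2 + δ + t * I))⁻¹‖ ^ 2 /
        (1 / 4 + t ^ 2)) ≤ ENNReal.ofReal (M t) := by
    filter_upwards [Ioo_mem_nhdsGT (show (0 : ℝ) < 1 / 2 by norm_num)] with δ hδ
    exact Eventually.of_forall fun t ↦ ENNReal.ofReal_le_ofReal (hT1 δ hδ.1 hδ.2 t)
  -- pointwise limit `0` off the zeros of `ζ` on the line
  have hlim : ∀ᵐ t : ℝ, Tendsto (fun δ : ℝ ↦ ENNReal.ofReal
      (‖1 - riemannZeta (1 / 2 + t * I) * (riemannZeta (1 / 2 + δ + t * I))⁻¹‖ ^ 2 /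
        (1 / 4 + t ^ 2))) (𝓝[>] 0) (𝓝 0) := by
    filter_upwards [BaezDuarteOnlyIf.ae_riemannZeta_half_ne_zero] with t ht
    have hs1 : (1 / 2 : ℂ) + t * I ≠ 1 := one_half_add_ne_one t
    have hcont : Tendsto (fun δ : ℝ ↦ riemannZeta (1 / 2 + δ + t * I)) (𝓝 0)
        (𝓝 (riemannZeta (1 / 2 + t * I))) := by
      have h1 : Tendsto (fun δ : ℝ ↦ (1 / 2 : ℂ) + δ + t * I) (𝓝 0) (𝓝 ((1 / 2 : ℂ) + t * I)) := by
        have : Continuous fun δ : ℝ ↦ (1 / 2 : ℂ) + δ + t * I := by fun_prop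
        have h := this.tendsto 0
        simpa using h
      exact ((differentiableAt_riemannZeta hs1).continuousAt.tendsto).comp h1
    have hlim' : Tendsto (fun δ : ℝ ↦ ENNReal.ofReal
        (‖1 - riemannZeta (1 / 2 + t * I) * (riemannZeta (1 / 2 + δ + t * I))⁻¹‖ ^ 2 /
          (1 / 4 + t ^ 2))) (𝓝 0) (𝓝 (ENNReal.ofReal
        (‖1 - riemannZeta (1 / 2 + t * I) * (riemannZeta (1 / 2 + t * I))⁻¹‖ ^ 2 /
          (1 / 4 + t ^ 2)))) := by
      refine ENNReal.tendsto_ofReal ?_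
      refine Tendsto.div_const (Tendsto.pow (Tendsto.norm ?_) 2) _
      exact tendsto_const_nhds.sub (tendsto_const_nhds.mul (hcont.inv₀ ht))
    rw [mul_inv_cancel₀ ht, sub_self, norm_zero, zero_pow two_ne_zero, zero_div,
      ENNReal.ofReal_zero] at hlim'
    exact tendsto_nhdsWithin_of_tendsto_nhds hlim'
  have key := tendsto_lintegral_filter_of_dominated_convergence (μ := volume)
    (fun t ↦ ENNReal.ofReal (M t)) hmeas hbound (Integrable.lintegral_lt_top hMint).ne hlim
  simpa using key

/-! ### The term `T₂ = ζ(s)(1/ζ(w) - M_n(w))` for fixed `δ` -/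

/-- **`T₂ → 0` for fixed `δ`.** Under RH, for `0 < δ ≤ 1/4` and `η > 0` there is `n ≥ 1` with
`∫ |ζ(1/2+it)|² |1/ζ(w) - M_n(w)|² dt/(1/4+t²) < η`, `w = 1/2 + δ + it`,
`M_n(w) = Σ_{a≤n} μ(a)(1-a/n)² a^{-w}`: the integrand is `≤ C n^{-δ} (1+|t|)^{-5/4}` by the ratio
bound, Littlewood's `ζ(w) = O((1+|t|)^{1/8})` and the Riesz–Perron estimate
`|1/ζ(w) - M_n(w)| ≤ C n^{-δ/2}(1+|t|)^{1/8}`. This is Báez-Duarte's step "`f_{ε,n} → f_ε` in `L²`"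
(§2.2). [cite: BaezDuarte2003, §2.2 (convergence `f_{ε,n} → f_ε`, via Lemma 2.1)] -/
theorem exists_lintegral_T2_lt (hRH : RiemannHypothesis) {δ : ℝ} (hδ0 : 0 < δ) (hδ : δ ≤ 1 / 4)
    {η : ℝ} (hη : 0 < η) :
    ∃ n : ℕ, 0 < n ∧ ∫⁻ t : ℝ, ENNReal.ofReal
      (‖riemannZeta (1 / 2 + t * I) * ((riemannZeta (1 / 2 + δ + t * I))⁻¹ -
        ∑ a ∈ Finset.range n, ((ArithmeticFunction.moebius (a + 1) : ℤ) : ℂ) *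
          ((((1 : ℝ) - ((a : ℝ) + 1) / n) ^ 2 : ℝ) : ℂ) *
          ((a : ℂ) + 1) ^ (-((1 / 2 : ℂ) + δ + t * I)))‖ ^ 2 / (1 / 4 + t ^ 2)) <
      ENNReal.ofReal η := by
  obtain ⟨CR, hCR, hratio⟩ := ZetaRatioRH.norm_riemannZeta_half_le_of_RH hRH
  obtain ⟨CL, hCL, hLitt⟩ := LittlewoodRH.norm_riemannZeta_line_le_of_RH hRH
    (σ := 1 / 2 + δ) (by linarith) (by linarith) (show (0 : ℝ) < 1 / 8 by norm_num)
  obtain ⟨CP, hCP, hPerron⟩ := RieszPerron.norm_rieszSum_sub_inv_riemannZeta_le hRH hδ0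
    (by linarith) (show (0 : ℝ) < 1 / 8 by norm_num) (by norm_num)
  set CT : ℝ := CR * CL * CP with hCT
  have hCT0 : 0 < CT := by positivity
  -- the integral of the weight
  have hr : (Module.finrank ℝ ℝ : ℝ) < 5 / 4 := by simp; norm_num
  have hJint := integrable_one_add_norm (E := ℝ) (μ := volume) hr
  set J : ℝ := ∫ t : ℝ, (1 + ‖t‖) ^ (-(5 / 4 : ℝ)) with hJ
  have hJ0 : 0 ≤ J := integral_nonneg fun t ↦ by positivity
  -- choose `n` with `8 CT² J n^{-δ} < η`
  have hlim : Tendsto (fun n : ℕ ↦ 8 * CT ^ 2 * J * (n : ℝ) ^ (-δ)) atTop (𝓝 0) := by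
    have h := (tendsto_rpow_neg_atTop hδ0).comp tendsto_natCast_atTop_atTop
    have := h.const_mul (8 * CT ^ 2 * J)
    simpa using this
  obtain ⟨n, hn1, hn2⟩ : ∃ n : ℕ, 0 < n ∧ 8 * CT ^ 2 * J * (n : ℝ) ^ (-δ) < η := by
    have hev := (hlim.eventually (gt_mem_nhds hη)).and (eventually_gt_atTop 0)
    obtain ⟨n, hn⟩ := hev.exists
    exact ⟨n, hn.2, hn.1⟩
  refine ⟨n, hn1, ?_⟩
  have hn' : (0 : ℝ) < n := by exact_mod_cast hn1
  -- pointwise bound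
  have hpt : ∀ t : ℝ, ‖riemannZeta (1 / 2 + t * I) * ((riemannZeta (1 / 2 + δ + t * I))⁻¹ -
        ∑ a ∈ Finset.range n, ((ArithmeticFunction.moebius (a + 1) : ℤ) : ℂ) *
          ((((1 : ℝ) - ((a : ℝ) + 1) / n) ^ 2 : ℝ) : ℂ) *
          ((a : ℂ) + 1) ^ (-((1 / 2 : ℂ) + δ + t * I)))‖ ^ 2 / (1 / 4 + t ^ 2) ≤
      8 * CT ^ 2 * J⁻¹ * J * (n : ℝ) ^ (-δ) * 0 +
        8 * CT ^ 2 * (n : ℝ) ^ (-δ) * (1 + ‖t‖) ^ (-(5 / 4 : ℝ)) := by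
    intro t
    have hcast : ((1 / 2 : ℂ) + δ + t * I) = (((1 / 2 + δ : ℝ)) : ℂ) + t * I := by push_cast; ring
    have hP := hPerron n hn1 t
    rw [← hcast] at hP
    have hζ : ‖riemannZeta (1 / 2 + t * I)‖ ≤
        CR * (1 + |t|) ^ (δ / 2) * (CL * (1 + |t|) ^ (1 / 8 : ℝ)) := by
      refine (hratio δ hδ0 (by linarith) t).trans ?_
      have hL := hLitt t
      have e : ((1 / 2 + δ : ℝ) : ℂ) + t * I = 1 / 2 + δ + t * I := by push_cast; ring
      rw [e] at hL
      gcongr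
    have hδ8 : (1 + |t|) ^ (δ / 2) ≤ (1 + |t|) ^ (1 / 8 : ℝ) :=
      Real.rpow_le_rpow_of_exponent_le (by linarith [abs_nonneg t]) (by linarith)
    have hnorm : ‖riemannZeta (1 / 2 + t * I) * ((riemannZeta (1 / 2 + δ + t * I))⁻¹ -
        ∑ a ∈ Finset.range n, ((ArithmeticFunction.moebius (a + 1) : ℤ) : ℂ) *
          ((((1 : ℝ) - ((a : ℝ) + 1) / n) ^ 2 : ℝ) : ℂ) *
          ((a : ℂ) + 1) ^ (-((1 / 2 : ℂ) + δ + t * I)))‖ ≤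
        CT * (n : ℝ) ^ (-(δ / 2)) * (1 + |t|) ^ (3 / 8 : ℝ) := by
      rw [norm_mul, norm_sub_rev]
      have h38 : (1 + |t|) ^ (3 / 8 : ℝ) = (1 + |t|) ^ (1 / 8 : ℝ) * (1 + |t|) ^ (1 / 8 : ℝ) *
          (1 + |t|) ^ (1 / 8 : ℝ) := by
        rw [← Real.rpow_add (by positivity), ← Real.rpow_add (by positivity)]; norm_num
      have h0 : 0 ≤ (1 + |t|) ^ (1 / 8 : ℝ) := by positivity
      calc ‖riemannZeta (1 / 2 + t * I)‖ * _
          ≤ (CR * (1 + |t|) ^ (δ / 2) * (CL * (1 + |t|) ^ (1 / 8 : ℝ))) *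
            (CP * (n : ℝ) ^ (-(δ / 2)) * (1 + |t|) ^ (1 / 8 : ℝ)) :=
            mul_le_mul hζ hP (norm_nonneg _) (by positivity)
        _ ≤ (CR * (1 + |t|) ^ (1 / 8 : ℝ) * (CL * (1 + |t|) ^ (1 / 8 : ℝ))) *
            (CP * (n : ℝ) ^ (-(δ / 2)) * (1 + |t|) ^ (1 / 8 : ℝ)) := by gcongr
        _ = CT * (n : ℝ) ^ (-(δ / 2)) * (1 + |t|) ^ (3 / 8 : ℝ) := by rw [h38, hCT]; ring
    have hsq : ‖riemannZeta (1 / 2 + t * I) * ((riemannZeta (1 / 2 + δ + t * I))⁻¹ -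
        ∑ a ∈ Finset.range n, ((ArithmeticFunction.moebius (a + 1) : ℤ) : ℂ) *
          ((((1 : ℝ) - ((a : ℝ) + 1) / n) ^ 2 : ℝ) : ℂ) *
          ((a : ℂ) + 1) ^ (-((1 / 2 : ℂ) + δ + t * I)))‖ ^ 2 ≤
        CT ^ 2 * (n : ℝ) ^ (-δ) * (1 + |t|) ^ (3 / 4 : ℝ) := by
      have h0 : 0 ≤ CT * (n : ℝ) ^ (-(δ / 2)) * (1 + |t|) ^ (3 / 8 : ℝ) := by positivity
      have := pow_le_pow_left₀ (norm_nonneg _) hnorm 2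
      refine this.trans_eq ?_
      have e1 : ((n : ℝ) ^ (-(δ / 2))) ^ 2 = (n : ℝ) ^ (-δ) := by
        rw [← Real.rpow_natCast, ← Real.rpow_mul hn'.le]; ring_nf
      have e2 : ((1 + |t|) ^ (3 / 8 : ℝ)) ^ 2 = (1 + |t|) ^ (3 / 4 : ℝ) := by
        rw [← Real.rpow_natCast, ← Real.rpow_mul (by positivity)]; norm_num
      rw [mul_pow, mul_pow, e1, e2]
    have hw := inv_quarter_add_sq_le t
    have hsplit :
        (1 + |t|) ^ (3 / 4 : ℝ) * (1 + |t|) ^ (-(2 : ℝ)) = (1 + |t|) ^ (-(5 / 4 : ℝ)) := by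
      rw [← Real.rpow_add (by positivity)]; norm_num
    rw [mul_zero, zero_add, Real.norm_eq_abs]
    calc _ = ‖riemannZeta (1 / 2 + t * I) * ((riemannZeta (1 / 2 + δ + t * I))⁻¹ -
        ∑ a ∈ Finset.range n, ((ArithmeticFunction.moebius (a + 1) : ℤ) : ℂ) *
          ((((1 : ℝ) - ((a : ℝ) + 1) / n) ^ 2 : ℝ) : ℂ) *
          ((a : ℂ) + 1) ^ (-((1 / 2 : ℂ) + δ + t * I)))‖ ^ 2 * (1 / (1 / 4 + t ^ 2)) := by ring
      _ ≤ (CT ^ 2 * (n : ℝ) ^ (-δ) * (1 + |t|) ^ (3 / 4 : ℝ)) * (8 * (1 + |t|) ^ (-(2 : ℝ))) := by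
          gcongr
      _ = 8 * CT ^ 2 * (n : ℝ) ^ (-δ) * (1 + |t|) ^ (-(5 / 4 : ℝ)) := by rw [← hsplit]; ring
  -- integrate
  have hle : ∫⁻ t : ℝ, ENNReal.ofReal
      (‖riemannZeta (1 / 2 + t * I) * ((riemannZeta (1 / 2 + δ + t * I))⁻¹ -
        ∑ a ∈ Finset.range n, ((ArithmeticFunction.moebius (a + 1) : ℤ) : ℂ) *
          ((((1 : ℝ) - ((a : ℝ) + 1) / n) ^ 2 : ℝ) : ℂ) *
          ((a : ℂ) + 1) ^ (-((1 / 2 : ℂ) + δ + t * I)))‖ ^ 2 / (1 / 4 + t ^ 2)) ≤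
      ENNReal.ofReal (8 * CT ^ 2 * (n : ℝ) ^ (-δ) * J) := by
    calc _ ≤ ∫⁻ t : ℝ,
          ENNReal.ofReal (8 * CT ^ 2 * (n : ℝ) ^ (-δ) * (1 + ‖t‖) ^ (-(5 / 4 : ℝ))) := by
          refine lintegral_mono fun t ↦ ENNReal.ofReal_le_ofReal ?_
          have := hpt t
          simp only [mul_zero, zero_add] at this
          exact this
      _ = ENNReal.ofReal (∫ t : ℝ, 8 * CT ^ 2 * (n : ℝ) ^ (-δ) * (1 + ‖t‖) ^ (-(5 / 4 : ℝ))) := by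
          rw [← ofReal_integral_eq_lintegral_ofReal (hJint.const_mul _)
            (Eventually.of_forall fun t ↦ by positivity)]
      _ = ENNReal.ofReal (8 * CT ^ 2 * (n : ℝ) ^ (-δ) * J) := by
          rw [integral_const_mul]
  refine hle.trans_lt ?_
  exact ENNReal.ofReal_lt_ofReal_iff_of_nonneg (by positivity) |>.mpr (by nlinarith [hn2])

/-! ### Assembly -/

/-- **Deep half of Báez-Duarte's Theorem 1.1, critical-line form: discharge of the named fact
`Literature.NumberTheory.LFunctions.baezDuarte_dirichlet_onlyIf`.** Under RH, for every `ε > 0` there is a Dirichlet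
polynomial `A(s) = Σ_{k<N} a_k (k+1)^{-s}` with `∫ |1 - ζ(1/2+it)A(1/2+it)|² dt/(1/4+t²) < ε`.
The polynomial is `A(s) = M_n(s + δ)`, i.e. `a_k = μ(k+1)(1-(k+1)/n)²(k+1)^{-δ}`, with `δ` small
(term `T₁`, `tendsto_lintegral_T1`) and then `n` large (term `T₂`, `exists_lintegral_T2_lt`),
via `|T₁ + T₂|² ≤ 2|T₁|² + 2|T₂|²`. [cite: BaezDuarte2003, Thm. 1.1 (only-if part), §2.2] -/
theorem baezDuarte_dirichlet_onlyIf_holds : baezDuarte_dirichlet_onlyIf := by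
  intro hRH ε hε
  have hε4 : (0 : ℝ≥0∞) < ENNReal.ofReal (ε / 4) := ENNReal.ofReal_pos.mpr (by positivity)
  -- choose `δ` (term `T₁`)
  obtain ⟨δ, hT1, hδ0, hδ⟩ : ∃ δ : ℝ, ∫⁻ t : ℝ, ENNReal.ofReal
      (‖1 - riemannZeta (1 / 2 + t * I) * (riemannZeta (1 / 2 + δ + t * I))⁻¹‖ ^ 2 /
        (1 / 4 + t ^ 2)) < ENNReal.ofReal (ε / 4) ∧ 0 < δ ∧ δ ≤ 1 / 4 := by
    have hev := ((tendsto_lintegral_T1 hRH).eventually (gt_mem_nhds hε4)).and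
      (Ioc_mem_nhdsGT (show (0 : ℝ) < 1 / 4 by norm_num))
    obtain ⟨δ, h1, h2⟩ := hev.exists
    exact ⟨δ, h1, h2.1, h2.2⟩
  -- choose `n` (term `T₂`)
  obtain ⟨n, hn, hT2⟩ := exists_lintegral_T2_lt hRH hδ0 hδ (show (0 : ℝ) < ε / 4 by positivity)
  -- the coefficients of `A(s) = M_n(s + δ)`
  set a : Fin n → ℂ := fun k ↦ ((ArithmeticFunction.moebius ((k : ℕ) + 1) : ℤ) : ℂ) *
    ((((1 : ℝ) - (((k : ℕ) : ℝ) + 1) / n) ^ 2 : ℝ) : ℂ) * (((k : ℕ) : ℂ) + 1) ^ (-(δ : ℂ)) with ha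
  refine ⟨n, a, ?_⟩
  have hsum : ∀ t : ℝ, ∑ k : Fin n, a k * (((k : ℕ) : ℂ) + 1) ^ (-(1 / 2 + t * I)) =
      ∑ b ∈ Finset.range n, ((ArithmeticFunction.moebius (b + 1) : ℤ) : ℂ) *
        ((((1 : ℝ) - ((b : ℝ) + 1) / n) ^ 2 : ℝ) : ℂ) *
        ((b : ℂ) + 1) ^ (-((1 / 2 : ℂ) + δ + t * I)) := by
    intro t
    rw [← Fin.sum_univ_eq_sum_range (fun b ↦ ((ArithmeticFunction.moebius (b + 1) : ℤ) : ℂ) *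
        ((((1 : ℝ) - ((b : ℝ) + 1) / n) ^ 2 : ℝ) : ℂ) *
        ((b : ℂ) + 1) ^ (-((1 / 2 : ℂ) + δ + t * I))) n]
    refine Finset.sum_congr rfl fun k _ ↦ ?_
    have hk : ((k : ℕ) : ℂ) + 1 ≠ 0 := natCast_add_one_ne_zero' k
    simp only [ha]
    rw [mul_assoc, ← cpow_add _ _ hk]
    congr 2
    ring
  -- pointwise splitting `1 - ζ M = T₁ + T₂`
  have hpt : ∀ t : ℝ, ENNReal.ofReal (‖1 - riemannZeta (1 / 2 + t * I) *
      ∑ k : Fin n, a k * (((k : ℕ) : ℂ) + 1) ^ (-(1 / 2 + t * I))‖ ^ 2 / (1 / 4 + t ^ 2)) ≤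
      2 * ENNReal.ofReal (‖1 - riemannZeta (1 / 2 + t * I) *
        (riemannZeta (1 / 2 + δ + t * I))⁻¹‖ ^ 2 / (1 / 4 + t ^ 2)) +
      2 * ENNReal.ofReal (‖riemannZeta (1 / 2 + t * I) * ((riemannZeta (1 / 2 + δ + t * I))⁻¹ -
        ∑ b ∈ Finset.range n, ((ArithmeticFunction.moebius (b + 1) : ℤ) : ℂ) *
          ((((1 : ℝ) - ((b : ℝ) + 1) / n) ^ 2 : ℝ) : ℂ) *
          ((b : ℂ) + 1) ^ (-((1 / 2 : ℂ) + δ + t * I)))‖ ^ 2 / (1 / 4 + t ^ 2)) := by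
    intro t
    rw [hsum t]
    set Z := riemannZeta (1 / 2 + t * I)
    set W := (riemannZeta (1 / 2 + δ + t * I))⁻¹
    set M := ∑ b ∈ Finset.range n, ((ArithmeticFunction.moebius (b + 1) : ℤ) : ℂ) *
          ((((1 : ℝ) - ((b : ℝ) + 1) / n) ^ 2 : ℝ) : ℂ) *
          ((b : ℂ) + 1) ^ (-((1 / 2 : ℂ) + δ + t * I))
    have hsplit : 1 - Z * M = (1 - Z * W) + Z * (W - M) := by ring
    have hq : 0 < 1 / 4 + t ^ 2 := by positivity
    have h2 := norm_add_sq_le_two (1 - Z * W) (Z * (W - M))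
    calc ENNReal.ofReal (‖1 - Z * M‖ ^ 2 / (1 / 4 + t ^ 2))
        ≤ ENNReal.ofReal ((2 * ‖1 - Z * W‖ ^ 2 + 2 * ‖Z * (W - M)‖ ^ 2) / (1 / 4 + t ^ 2)) := by
          rw [hsplit]
          exact ENNReal.ofReal_le_ofReal (div_le_div_of_nonneg_right h2 hq.le)
      _ = ENNReal.ofReal (2 * (‖1 - Z * W‖ ^ 2 / (1 / 4 + t ^ 2)) +
            2 * (‖Z * (W - M)‖ ^ 2 / (1 / 4 + t ^ 2))) := by
          congr 1; ring
      _ = 2 * ENNReal.ofReal (‖1 - Z * W‖ ^ 2 / (1 / 4 + t ^ 2)) +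
            2 * ENNReal.ofReal (‖Z * (W - M)‖ ^ 2 / (1 / 4 + t ^ 2)) := by
          rw [ENNReal.ofReal_add (by positivity) (by positivity), ENNReal.ofReal_mul (by norm_num),
            ENNReal.ofReal_mul (by norm_num), ENNReal.ofReal_ofNat]
  -- measurability of the `T₁`-integrand
  have hmeas : Measurable fun t : ℝ ↦ 2 * ENNReal.ofReal (‖1 - riemannZeta (1 / 2 + t * I) *
        (riemannZeta (1 / 2 + δ + t * I))⁻¹‖ ^ 2 / (1 / 4 + t ^ 2)) := by
    refine Measurable.const_mul (ENNReal.measurable_ofReal.comp (Continuous.measurable ?_)) _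
    refine Continuous.div ((continuous_const.sub (continuous_riemannZeta_line.mul
      (continuous_inv_riemannZeta_line hRH hδ0 (by linarith)))).norm.pow 2) (by fun_prop)
      (fun t ↦ by positivity)
  have h2top : (2 : ℝ≥0∞) ≠ ⊤ := ENNReal.ofNat_ne_top
  have h2ne : (2 : ℝ≥0∞) ≠ 0 := two_ne_zero
  calc _ ≤ ∫⁻ t : ℝ, (2 * ENNReal.ofReal (‖1 - riemannZeta (1 / 2 + t * I) *
        (riemannZeta (1 / 2 + δ + t * I))⁻¹‖ ^ 2 / (1 / 4 + t ^ 2)) +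
      2 * ENNReal.ofReal (‖riemannZeta (1 / 2 + t * I) * ((riemannZeta (1 / 2 + δ + t * I))⁻¹ -
        ∑ b ∈ Finset.range n, ((ArithmeticFunction.moebius (b + 1) : ℤ) : ℂ) *
          ((((1 : ℝ) - ((b : ℝ) + 1) / n) ^ 2 : ℝ) : ℂ) *
          ((b : ℂ) + 1) ^ (-((1 / 2 : ℂ) + δ + t * I)))‖ ^ 2 / (1 / 4 + t ^ 2))) :=
        lintegral_mono fun t ↦ hpt t
    _ = (2 * ∫⁻ t : ℝ, ENNReal.ofReal (‖1 - riemannZeta (1 / 2 + t * I) *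
        (riemannZeta (1 / 2 + δ + t * I))⁻¹‖ ^ 2 / (1 / 4 + t ^ 2))) +
      2 * ∫⁻ t : ℝ, ENNReal.ofReal (‖riemannZeta (1 / 2 + t * I) *
        ((riemannZeta (1 / 2 + δ + t * I))⁻¹ -
        ∑ b ∈ Finset.range n, ((ArithmeticFunction.moebius (b + 1) : ℤ) : ℂ) *
          ((((1 : ℝ) - ((b : ℝ) + 1) / n) ^ 2 : ℝ) : ℂ) *
          ((b : ℂ) + 1) ^ (-((1 / 2 : ℂ) + δ + t * I)))‖ ^ 2 / (1 / 4 + t ^ 2)) := by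
        rw [lintegral_add_left hmeas, lintegral_const_mul' _ _ h2top,
          lintegral_const_mul' _ _ h2top]
    _ < 2 * ENNReal.ofReal (ε / 4) + 2 * ENNReal.ofReal (ε / 4) :=
        ENNReal.add_lt_add (ENNReal.mul_lt_mul_right h2ne h2top hT1)
          (ENNReal.mul_lt_mul_right h2ne h2top hT2)
    _ = ENNReal.ofReal ε := by
        rw [← ENNReal.ofReal_ofNat 2, ← ENNReal.ofReal_mul (by norm_num),
          ← ENNReal.ofReal_add (by positivity) (by positivity)]
        congr 1
        ring

/-- **Discharge of `Literature.NumberTheory.LFunctions.baezDuarte_dirichlet_iff` (rh.S27, Mellin form).** Báez-Duarte's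
Theorem 1.1 read on the critical line: RH holds iff for every `ε > 0` some Dirichlet polynomial
`A(s) = Σ_{k<N} a_k (k+1)^{-s}` has `∫_ℝ |1 - ζ(1/2+it) A(1/2+it)|² dt/(1/4+t²) < ε`. The elementary
half is `riemannHypothesis_of_dirichlet_approx` (`NymanBeurlingDirichlet.lean`), the deep half
`baezDuarte_dirichlet_onlyIf_holds` above. [cite: BaezDuarte2003, Thm. 1.1] -/
theorem baezDuarte_dirichlet_iff_holds : baezDuarte_dirichlet_iff :=
  baezDuarte_dirichlet_iff_of_onlyIf baezDuarte_dirichlet_onlyIf_holds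

end Literature.NumberTheory.LFunctions

end
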